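import Mathlib.Analysis.InnerProductSpace.PiL2
import Mathlib.Analysis.Calculus.ContDiff.Defs
import Literature.Analysis.Fourier.LpMultiplier
import HarnessLib

/-!
# `Ẇ^{1,p}` bounds for Fourier multiplier operators, Riesz transforms, and the two
harmonic-analysis inputs of Rauch's `Lᵖ` argument

For a matrix symbol `M : ℝᵈ → Matrix κ ι ℂ` and its operator `M(D) = 𝓕⁻¹ M 𝓕` (`multiplierOp`,
`Literature/Analysis/Fourier/LpMultiplier.lean`), the **homogeneous Sobolev bound**
`HasGradientLpBoundWith p C M`: for every test function `φ ∈ C_c^∞(ℝᵈ; ℂ^ι)`,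
`Σⱼ ‖M(D)(∂ⱼφ)‖_{Lᵖ} ≤ C Σⱼ ‖∂ⱼφ‖_{Lᵖ}` — `M(D)` is bounded on `Ẇ^{1,p}` in the form in which
such bounds arise from a PDE estimate `‖∇ₓv(T)‖_{Lᵖ} ≤ c‖∇ₓφ‖_{Lᵖ}` for the solution
`v(T) = M(D)φ` of a constant-coefficient Cauchy problem [Rauch1986, (5) p. 483]. This file
records the two facts of harmonic analysis by which [Rauch1986, Proof of Theorem p. 483] turns
the `L¹` and `L²` gradient bounds into `M ∈ M_p`, `1 < p ≤ 2`:

1. `gradientLpBound_interpolation` — "Interpolating, (5) is valid for `Lᵖ`, `1 < p < 2`"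
   [Rauch1986, p. 483]: an `Ẇ^{1,1}`- and `Ẇ^{1,2}`-bound for `M(D)` give an `Ẇ^{1,p}`-bound,
   `1 < p < 2`. Since the bound lives on the (non-complemented) subspace of gradients of
   `Lᵖ(ℝᵈ; ℂ^{dι})`, this is NOT the Riesz–Thorin theorem but the real interpolation of the
   homogeneous Sobolev spaces, `(Ẇ¹₁, Ẇ¹₂)_{θ,p} = Ẇ¹_p` [Badr2009, Thm 1.4 and Cor. 5.9, for
   `M = ℝⁿ` where `q₀ = 1`] (the inhomogeneous case `(W¹₁, W¹_∞)` is [DeVoreScherer1979]),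
   combined with `(L¹, L²)_{θ,p} = Lᵖ`.
2. `isLpMultiplier_of_gradientLpBound` — Rauch's (6) and the following paragraph
   [Rauch1986, p. 483]: for `1 < p < ∞` a bounded symbol with an `Ẇ^{1,p}`-bound is an `Lᵖ`
   multiplier: with `ψ = |D|χ`, "`Dⱼ/|D|` is a bounded operator on `Lᵖ(ℝⁿ)`" (the Riesz
   transforms, `rieszTransform_isLpMultiplier` [Grafakos2014, Prop. 5.1.14 and Cor. 5.2.8]),
   "`|D|C₀^∞(ℝⁿ)` ... is a dense subset of `Lᵖ`, so `D_l M^{αβ}(D)/|D|` is a bounded operator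
   on `Lᵖ` ... To show that `M(D)` is itself bounded, multiply by `D_l/|D| ∈ Hom(Lᵖ)` and sum
   on `l`" (`-I = Σⱼ Rⱼ²` [Grafakos2014, Prop. 5.1.16]; `M_p` is an algebra
   [Grafakos2014, Prop. 2.5.13]).

Also recorded: the Riesz symbols `rieszSymbol j ξ = -iξⱼ/|ξ|` and the `Lᵖ`-boundedness of the
Riesz transforms as the named fact `rieszTransform_isLpMultiplier` (Calderón–Zygmund theory,
not in Mathlib), the input of a future proof of fact 2.

## Design

* Test functions in `HasGradientLpBoundWith` are `C_c^∞` (`ContDiff ℝ ∞ φ ∧ HasCompactSupport φ`,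
  plain functions), as in [Rauch1986, (5)] ("`∀ φ ∈ C₀^∞`"); `∂ⱼφ = Dφ(·)[eⱼ]` (`partialDeriv`)
  with `eⱼ = EuclideanSpace.single j 1`, as in
  `Literature.Barriers.AtomisticToContinuum.QuasilinearSystem.IsClassicalSolution`. As in
  `IsLpMultiplierWith`, the predicate carries the guard that `M · 𝓕(∂ⱼφ)` is integrable, so
  that `M(D)(∂ⱼφ)` is the genuine inverse Fourier integral (automatic for bounded measurable
  `M`). Exponents `p : ℝ≥0∞` are unrestricted in the definition, meaningful for `1 ≤ p ≤ ∞`.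
* Symbols in the two facts are bounded and (entrywise) measurable, rectangular
  `Fin k' × Fin k`; vector norms on `ℂ^ι` are the sup norms (constants, not the classes,
  depend on this choice).

What is NOT here: proofs of the three facts (each a theory: Calderón–Zygmund decomposition
of Sobolev functions / `K`-functionals for 1; singular integrals for the Riesz transforms;
for 2, in addition, the density of `|D|𝒮` in `Lᵖ`, `p > 1`, and limiting arguments).

## References

* [Rauch1986] J. Rauch, Comm. Math. Phys. 106 (1986) 481–484, Proof of Theorem p. 483, (5)–(6).
* [Badr2009] N. Badr, *Real interpolation of Sobolev spaces*, Math. Scand. 105 (2009) 235–264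
  (arXiv:0705.2216): Thm 1.4, Thm 5.5, Cor. 5.9 (homogeneous spaces, `M = ℝⁿ`).
* [DeVoreScherer1979] R. DeVore, K. Scherer, *Interpolation of linear operators on Sobolev
  spaces*, Ann. of Math. 109 (1979) 583–599.
* [Grafakos2014] L. Grafakos, *Classical Fourier Analysis*, 3rd ed., GTM 249 (2014): Def. 2.5.11,
  Prop. 2.5.13 (`M_p` a Banach algebra), Def. 5.1.13, Prop. 5.1.14 (`Rⱼ ↔ -iξⱼ/|ξ|`),
  Prop. 5.1.16 (`-I = Σ Rⱼ²`), Cor. 5.2.8 (`Rⱼ` bounded on `Lᵖ`, `1 < p < ∞`).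
-/

noncomputable section

open MeasureTheory FourierTransform
open scoped ENNReal NNReal ContDiff

namespace Literature.Analysis.Fourier

variable {d : ℕ} {F : Type*} [NormedAddCommGroup F] [NormedSpace ℝ F]
  {ι κ : Type*} [Fintype ι] [Fintype κ]

/-! ### Partial derivatives and the `Ẇ^{1,p}` bound -/

/-- The partial derivative `∂ⱼφ(x) = Dφ(x)[eⱼ]` of a map on `ℝᵈ` (`eⱼ = EuclideanSpace.single j 1`;
the Fréchet derivative, junk value `0` where `φ` is not differentiable). [folklore] -/
def partialDeriv (j : Fin d) (φ : EuclideanSpace ℝ (Fin d) → F) : EuclideanSpace ℝ (Fin d) → F :=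
  fun x => fderiv ℝ φ x (EuclideanSpace.single j 1)

/-- Unfolding `partialDeriv`. [folklore] -/
theorem partialDeriv_apply (j : Fin d) (φ : EuclideanSpace ℝ (Fin d) → F)
    (x : EuclideanSpace ℝ (Fin d)) :
    partialDeriv j φ x = fderiv ℝ φ x (EuclideanSpace.single j 1) := rfl

/-- **`Ẇ^{1,p}` bound for `M(D)` with constant `C`** (meaningful for `1 ≤ p ≤ ∞`): for every
`φ ∈ C_c^∞(ℝᵈ; ℂ^ι)` and every `j`, `M · 𝓕(∂ⱼφ)` is integrable (guard: `M(D)(∂ⱼφ)` is the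
genuine inverse Fourier integral), and `Σⱼ ‖M(D)(∂ⱼφ)‖_{Lᵖ} ≤ C Σⱼ ‖∂ⱼφ‖_{Lᵖ}` — the form of
the estimate "(5) `‖∇ₓv(t̄)‖_{Lᵖ} ≤ c‖∇ₓφ‖_{Lᵖ}`, `∀ φ ∈ C₀^∞`" for `v(t̄) = M(D)φ`, in which
`∇ₓ M(D)φ = M(D)∇ₓφ`. [cite: Rauch1986, Proof of Theorem p. 483, (5)] -/
def HasGradientLpBoundWith (p : ℝ≥0∞) (C : ℝ≥0)
    (M : EuclideanSpace ℝ (Fin d) → Matrix κ ι ℂ) : Prop :=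
  ∀ φ : EuclideanSpace ℝ (Fin d) → ι → ℂ, ContDiff ℝ ∞ φ → HasCompactSupport φ →
    (∀ j, Integrable (fun ξ => (M ξ).mulVec (𝓕 (partialDeriv j φ) ξ))) ∧
      ∑ j, eLpNorm (multiplierOp M (partialDeriv j φ)) p volume ≤
        C * ∑ j, eLpNorm (partialDeriv j φ) p volume

namespace HasGradientLpBoundWith

variable {p : ℝ≥0∞} {C C' : ℝ≥0} {M : EuclideanSpace ℝ (Fin d) → Matrix κ ι ℂ}

/-- The guard: `M · 𝓕(∂ⱼφ)` is integrable for test functions `φ`. [folklore] -/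
theorem integrable (h : HasGradientLpBoundWith p C M) {φ : EuclideanSpace ℝ (Fin d) → ι → ℂ}
    (hφ : ContDiff ℝ ∞ φ) (hc : HasCompactSupport φ) (j : Fin d) :
    Integrable (fun ξ => (M ξ).mulVec (𝓕 (partialDeriv j φ) ξ)) :=
  (h φ hφ hc).1 j

/-- The bound `Σⱼ ‖M(D)∂ⱼφ‖_p ≤ C Σⱼ ‖∂ⱼφ‖_p`. [cite: Rauch1986, Proof of Theorem p. 483, (5)] -/
theorem bound (h : HasGradientLpBoundWith p C M) {φ : EuclideanSpace ℝ (Fin d) → ι → ℂ}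
    (hφ : ContDiff ℝ ∞ φ) (hc : HasCompactSupport φ) :
    ∑ j, eLpNorm (multiplierOp M (partialDeriv j φ)) p volume ≤
      C * ∑ j, eLpNorm (partialDeriv j φ) p volume :=
  (h φ hφ hc).2

/-- A bound with constant `C` is a bound with any larger constant. [folklore] -/
theorem mono (h : HasGradientLpBoundWith p C M) (hC : C ≤ C') : HasGradientLpBoundWith p C' M :=
  fun φ hφ hc => ⟨(h φ hφ hc).1, (h φ hφ hc).2.trans (by gcongr)⟩

end HasGradientLpBoundWith

/-- **Non-vacuity:** the identity symbol has the `Ẇ^{1,p}` bound with constant `1`, for every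
`p`: `𝓕(∂ⱼφ)` is integrable (a `C_c^∞` function is Schwartz) and `1(D)∂ⱼφ = ∂ⱼφ` by Fourier
inversion. [folklore] -/
theorem hasGradientLpBoundWith_one [DecidableEq ι] (p : ℝ≥0∞) :
    HasGradientLpBoundWith (d := d) p 1 (1 : EuclideanSpace ℝ (Fin d) → Matrix ι ι ℂ) := by
  intro φ hφ hc
  have hS : ∀ j, ∃ g : SchwartzMap (EuclideanSpace ℝ (Fin d)) (ι → ℂ), ⇑g = partialDeriv j φ := by
    intro j
    have h1 : ContDiff ℝ ∞ (partialDeriv j φ) := by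
      have := hφ.fderiv_right (m := ∞) (by norm_cast)
      exact this.clm_apply contDiff_const
    have h2 : HasCompactSupport (partialDeriv j φ) :=
      (hc.fderiv ℝ).mono fun x hx => by
        simp only [Function.mem_support, ne_eq, partialDeriv] at hx ⊢
        intro h0
        exact hx (by rw [h0, _root_.zero_apply])
    exact ⟨h2.toSchwartzMap h1, rfl⟩
  refine ⟨fun j => ?_, ?_⟩
  · obtain ⟨g, hg⟩ := hS j
    rw [← hg]
    exact (isLpMultiplierWith_one p).integrable g
  · rw [ENNReal.coe_one, one_mul]
    refine Finset.sum_le_sum fun j _ => ?_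
    obtain ⟨g, hg⟩ := hS j
    rw [← hg, multiplierOp_one]

/-! ### Riesz transforms -/

/-- The symbol `-iξⱼ/|ξ|` of the `j`-th **Riesz transform** `Rⱼ = ∂ⱼ(-Δ)^{-1/2}`,
`Rⱼf = (-iξⱼ/|ξ| f̂)^∨` (value `0` at `ξ = 0`, a null set). [cite: Grafakos2014, Prop. 5.1.14] -/
def rieszSymbol (j : Fin d) (ξ : EuclideanSpace ℝ (Fin d)) : ℂ :=
  -Complex.I * ((ξ j / ‖ξ‖ : ℝ) : ℂ)

/-- `|rⱼ(ξ)| ≤ 1`. [cite: Grafakos2014, Prop. 5.1.14] -/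
theorem norm_rieszSymbol_le (j : Fin d) (ξ : EuclideanSpace ℝ (Fin d)) : ‖rieszSymbol j ξ‖ ≤ 1 := by
  rw [rieszSymbol, norm_mul, norm_neg, Complex.norm_I, one_mul, Complex.norm_real, norm_div,
    norm_norm]
  rcases eq_or_ne ‖ξ‖ 0 with h | h
  · rw [h, div_zero]; exact zero_le_one
  · rw [div_le_one (lt_of_le_of_ne (norm_nonneg _) (Ne.symm h))]
    simpa using PiLp.norm_apply_le ξ j

/-- `Σⱼ rⱼ(ξ)² = -1` for `ξ ≠ 0` (`-I = Σⱼ Rⱼ²`). [cite: Grafakos2014, Prop. 5.1.16] -/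
theorem sum_rieszSymbol_sq {ξ : EuclideanSpace ℝ (Fin d)} (hξ : ξ ≠ 0) :
    ∑ j, rieszSymbol j ξ ^ 2 = -1 := by
  have hn : ‖ξ‖ ≠ 0 := norm_ne_zero_iff.2 hξ
  have hsum : ∑ j, (ξ j / ‖ξ‖) ^ 2 = 1 := by
    simp_rw [div_pow, ← Finset.sum_div]
    rw [EuclideanSpace.norm_eq, Real.sq_sqrt (Finset.sum_nonneg fun _ _ => sq_nonneg _)]
    simp_rw [Real.norm_eq_abs, sq_abs]
    exact div_self (by
      intro h0
      apply hn
      rw [EuclideanSpace.norm_eq]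
      simp_rw [Real.norm_eq_abs, sq_abs]
      rw [h0, Real.sqrt_zero])
  simp only [rieszSymbol, mul_pow, neg_sq, Complex.I_sq]
  rw [← Finset.mul_sum, neg_one_mul, neg_inj]
  exact_mod_cast hsum

/-- **The Riesz transforms are bounded on `Lᵖ(ℝᵈ)`, `1 < p < ∞`** (named fact, NOT proved here:
the Calderón–Zygmund theory of singular integrals with odd kernels; not in Mathlib). Stated for
the symbol `rⱼ(ξ)·1` acting diagonally on `ℂᵏ`-valued functions (componentwise `Rⱼ`).
[cite: Grafakos2014, Cor. 5.2.8 and Prop. 5.1.14] -/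
def rieszTransform_isLpMultiplier : Prop :=
  ∀ ⦃d k : ℕ⦄ (j : Fin d) (p : ℝ≥0∞), 1 < p → p < ⊤ →
    IsLpMultiplier p (fun ξ => rieszSymbol j ξ • (1 : Matrix (Fin k) (Fin k) ℂ))

/-! ### The two harmonic-analysis inputs of Rauch's reduction (named facts) -/

/-- **Interpolation of `Ẇ^{1,p}` bounds between `p = 1` and `p = 2`** (named fact, NOT proved
here). For a bounded, measurable matrix symbol `M` on `ℝᵈ`: if `M(D)` has the `Ẇ^{1,1}` bound
with constant `c₁` and the `Ẇ^{1,2}` bound with constant `c₂` (on `C_c^∞` test functions), then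
for every `1 < p < 2` it has an `Ẇ^{1,p}` bound with some constant `c = c(p, d, c₁, c₂)`.
This is Rauch's "Interpolating, (5) is valid for `Lᵖ`, `1 < p < 2`" [Rauch1986, p. 483]
(there with `c` independent of `p`; only the existence of `c` is asserted here). The bounds
live on the subspace of gradients, so the justification is the real interpolation of the
homogeneous Sobolev spaces on `ℝᵈ` (which satisfies doubling and the `1`-Poincaré
inequality): `Ẇ¹_p` is a real interpolation space between `Ẇ¹₁` and `Ẇ¹₂`,
`(Ẇ¹₁, Ẇ¹₂)_{θ,p} = Ẇ¹_p`, `1/p = 1 - θ/2` [Badr2009, Thm 1.4, Thm 5.5 and Cor. 5.9 (the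
reiteration theorem), `M = ℝⁿ`, `q₀ = 1`], applied to the operator `φ ↦ ∇M(D)φ` into the
couple `(L¹, L²)` with `(L¹, L²)_{θ,p} = Lᵖ`; the inhomogeneous statement on `ℝⁿ` is
[DeVoreScherer1979]. (Passage from `C_c^∞` to the Sobolev spaces: `M(D)` is `L²`-bounded
since `M` is bounded, and Fatou.)
[cite: Badr2009, Thm 1.4 and Cor. 5.9; Rauch1986, Proof of Theorem p. 483] -/
def gradientLpBound_interpolation : Prop :=
  ∀ ⦃d k k' : ℕ⦄ (M : EuclideanSpace ℝ (Fin d) → Matrix (Fin k') (Fin k) ℂ),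
    (∀ a b, Measurable fun ξ => M ξ a b) → (∃ C₀ : ℝ, ∀ ξ a b, ‖M ξ a b‖ ≤ C₀) →
    ∀ ⦃c₁ c₂ : ℝ≥0⦄, HasGradientLpBoundWith 1 c₁ M → HasGradientLpBoundWith 2 c₂ M →
      ∀ p : ℝ≥0∞, 1 < p → p < 2 → ∃ c : ℝ≥0, HasGradientLpBoundWith p c M

/-- **An `Ẇ^{1,p}`-bounded bounded symbol is an `Lᵖ` multiplier, `1 < p < ∞`** (named fact,
NOT proved here; Rauch's (6) and the paragraph following it). For a bounded, measurable matrix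
symbol `M` on `ℝᵈ` and `1 < p < ∞`: if `Σⱼ ‖M(D)∂ⱼφ‖_p ≤ c Σⱼ ‖∂ⱼφ‖_p` for all
`φ ∈ C_c^∞`, then `M ∈ M_p` (`IsLpMultiplier`). Printed argument [Rauch1986, p. 483]: with
`ψ = |D|χ`, (6) `‖D_l M^{αβ}(D)|D|⁻¹ψ‖_{Lᵖ} ≤ c Σⱼ ‖Dⱼ|D|⁻¹ψ‖_{Lᵖ}`; "for `1 < p < ∞`,
`Dⱼ/|D|` is a bounded operator on `Lᵖ(ℝⁿ)`" (the Riesz transforms `rieszSymbol`,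
`rieszTransform_isLpMultiplier` [Grafakos2014, Prop. 5.1.14, Cor. 5.2.8]) "so
`‖D_l M^{αβ}(D)|D|⁻¹ψ‖_{Lᵖ} ≤ C_p‖ψ‖_{Lᵖ}`. This holds for all `ψ ∈ |D|C₀^∞(ℝⁿ)` which is a
dense subset of `Lᵖ`, so `D_l M^{αβ}(D)/|D|` is a bounded operator on `Lᵖ(ℝⁿ)` ... To show
that `M(D)` is itself bounded, multiply by `D_l/|D| ∈ Hom(Lᵖ)` and sum on `l`"
(`-I = Σ_l R_l²` [Grafakos2014, Prop. 5.1.16]; products of `Lᵖ` multipliers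
[Grafakos2014, Prop. 2.5.13]). For `d = 0` the hypothesis is empty and the conclusion holds
because `M` is bounded (`ℝ⁰` is a point).
[cite: Rauch1986, Proof of Theorem p. 483, (6); Grafakos2014, Cor. 5.2.8 and Prop. 5.1.16] -/
def isLpMultiplier_of_gradientLpBound : Prop :=
  ∀ ⦃d k k' : ℕ⦄ (M : EuclideanSpace ℝ (Fin d) → Matrix (Fin k') (Fin k) ℂ),
    (∀ a b, Measurable fun ξ => M ξ a b) → (∃ C₀ : ℝ, ∀ ξ a b, ‖M ξ a b‖ ≤ C₀) →
    ∀ (p : ℝ≥0∞) (c : ℝ≥0), 1 < p → p < ⊤ → HasGradientLpBoundWith p c M → IsLpMultiplier p M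

end Literature.Analysis.Fourier

end
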